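import Literature.AlgebraicGeometry.Resolution.KollarSurfaceOrderReductionTameGlobal
import Literature.AlgebraicGeometry.Resolution.SncSaturatedCentre
import HarnessLib

/-!
# Order reduction on surfaces, tame regime: a hypersurface part of the cosupport plus finitely many points

Topic: `Literature/AlgebraicGeometry/Resolution`. Kollár's 3.111 Step 1 ("if a component of the
cosupport has codimension one, it is smooth and we blow it up") made global and combined with the
finite-cosupport theorem (`KollarSurfaceOrderReductionTameGlobal.lean`; J. Kollár, *Lectures on
Resolution of Singularities* (2007), Thm. 3.69, 3.105, 3.111 Step 1; BGMW arXiv:1206.3090,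
Def. 3.1.3, Thm. 8.0.4): if `P` is the ideal sheaf of a regular hypersurface (order-one stalk
generators) along which `𝓘 = P^b` stalkwise, and the cosupport of `(𝓘, b)` off `V(P)` is a finite
set of closed points of dimension `≤ 2`, then ONE blowing up of `V(P)` (an isomorphism of schemes
making the controlled transform trivial over `V(P)`) followed by the global sequence of the
finite-cosupport theorem (applied with the exceptional boundary `[π^*P]`, disjoint from the
remaining cosupport) resolves `(X, 𝓘, ∅, b)`.

* `Kollar2007.stalkIdeal_transform_eq_top_of_stalkIdeal_eq_pow` — over `V(P)` the controlled
  transform `(π^*𝓘 : (π^*P)^b)` is the unit ideal when `𝓘_x = P_x^b`;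
* **`Kollar2007.exists_isResolutionOf_of_hypersurface_part`** — the statement above, for `X` smooth
  over a perfect field of characteristic `p` (`p = 0` allowed), `max-ord 𝓘 ≤ b`, `1 ≤ b < p`.

On a surface this is the shape of every tame cosupport (a regular curve along which `𝓘 = P^b`,
`KollarSurfaceOrderReductionTameLocal.stalkIdeal_eq_span_pow_of_specializes`, plus finitely many
closed points); the identification of the curve part of `cosupp(𝓘, b)` with such a `P` is not made
here.

## Sources

* J. Kollár, *Lectures on Resolution of Singularities* (2007): Thm. 3.69, 3.105, 3.111 Step 1. [Kollar2007]
* E. Bierstone, D. Grigoriev, P. Milman, J. Włodarczyk, arXiv:1206.3090: Def. 3.1.3, Thm. 8.0.4.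
  [BierstoneGrigorievMilmanWlodarczyk2011]
-/

noncomputable section

open CategoryTheory CategoryTheory.Limits AlgebraicGeometry TopologicalSpace IsLocalRing
  Scheme.IdealSheafData

namespace Literature.AlgebraicGeometry.Resolution

universe u

namespace Kollar2007

variable (k : Type u) [Field k]

/-- **Over `V(P)` the controlled transform of `𝓘 = P^b` is the unit ideal**: at a point `y` of a
blowing up `π` of `P` over `x ∈ V(P)` with `𝓘_x = P_x^b`, `(π^*𝓘 : (π^*P)^b)_y = ⊤` (`X'` locally
Noetherian). [cite: Kollar2007, 3.111 Step 1 (p. 176)] -/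
theorem stalkIdeal_controlledTransform_eq_top_of_stalkIdeal_eq_pow {X X' : Scheme.{u}}
    [IsLocallyNoetherian X'] (π : X' ⟶ X) (P I : X.IdealSheafData) (b : ℕ) {y : X'}
    (h : stalkIdeal I (π y) = stalkIdeal P (π y) ^ b) :
    stalkIdeal (controlledTransform π P I b) y = ⊤ := by
  rw [controlledTransform, stalkIdeal_colon, stalkIdeal_pow, stalkIdeal_comap_eq_map,
    stalkIdeal_comap_eq_map, h, Ideal.map_pow]
  exact colon_eq_top_of_le le_rfl

/-- **A hypersurface part of the cosupport plus finitely many points, tame regime.** Let `X` be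
smooth over a perfect field `k` of characteristic `p` (`p = 0` allowed), `𝓘` with `max-ord 𝓘 ≤ b`,
`1 ≤ b`, `p = 0 ∨ b < p`; let `P` be an ideal sheaf with order-one stalk generators (a regular
hypersurface `V(P)`) such that `𝓘_x = P_x^b` at every `x ∈ V(P)`, and assume that
`cosupp(𝓘, b) ∖ V(P)` is a finite set of closed points of dimension `≤ 2`. Then there is a smooth
blow-up sequence RESOLVING `(X, 𝓘, ∅, b)` (BGMW Def. 3.1.3): the blowing up of `V(P)` (Kollár
3.111 Step 1) followed by the global sequence of `exists_isResolutionOf_of_finite_support_boundary`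
on `Bl_{V(P)} X ≅ X` with boundary `[π^*P]`. [cite: Kollar2007, Thm. 3.69, 3.105, 3.111 Step 1]
[cite: BierstoneGrigorievMilmanWlodarczyk2011, Def. 3.1.3, Thm. 8.0.4] -/
theorem exists_isResolutionOf_of_hypersurface_part (X : Scheme.{u}) [X.Over (Spec (.of k))] (p : ℕ)
    [CharP k p] [PerfectField k] [Smooth (X ↘ Spec (.of k))] (I : X.IdealSheafData) {b : ℕ}
    (hb : 1 ≤ b) (hbp : p = 0 ∨ b < p) (hmax : ∀ x : X, idealOrder I x ≤ b) (P : X.IdealSheafData)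
    (hP : ∀ x ∈ P.support, ∃ v : X.presheaf.stalk x,
      stalkIdeal P x = Ideal.span {v} ∧ v ∉ (maximalIdeal (X.presheaf.stalk x)) ^ 2)
    (hIP : ∀ x ∈ P.support, stalkIdeal I x = stalkIdeal P x ^ b)
    (hfin : ((⟨I, [], b⟩ : MarkedIdeal X).support \ P.support).Finite)
    (hcl : ∀ x ∈ (⟨I, [], b⟩ : MarkedIdeal X).support \ P.support, IsClosed ({x} : Set X))
    (hdim : ∀ x ∈ (⟨I, [], b⟩ : MarkedIdeal X).support \ P.support,
      ringKrullDim (X.presheaf.stalk x) ≤ 2) :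
    ∃ s : CentreSeq X, s.IsResolutionOf ⟨I, [], b⟩ := by
  classical
  haveI : IsLocallyNoetherian X := isLocallyNoetherian_of_locallyOfFiniteType_over k X
  have hXreg : Scheme.IsRegular X := Scheme.isRegular_of_smooth_over_field k X
  set M : MarkedIdeal X := ⟨I, [], b⟩ with hM
  -- Step 1: blow up `V(P)`
  haveI : IsLocallyNoetherian (blowup P) := CentreSeq.isLocallyNoetherian_blowup P
  set t : CentreSeq X := CentreSeq.cons P (CentreSeq.nil (blowup P)) with ht
  have hPsupp : (P.support : Set X) ⊆ M.support := fun x hx => by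
    rw [MarkedIdeal.mem_support_iff]
    change stalkIdeal I x ≤ _
    rw [hIP x hx]
    exact Ideal.pow_right_mono ((mem_support_iff_stalkIdeal_le P x).mp hx) b
  have hPsnc : HasSNCWith ([] : List X.IdealSheafData) P := by
    have h1 := (hasSNC_singleton_of_generator hXreg hP).hasSNCWith_finsetSup {P} (by simp)
    rw [Finset.sup_singleton, id] at h1
    exact h1.of_cons
  have hPreg : Scheme.IsRegular P.subscheme := isRegular_subscheme_of_generator _ hXreg hP
  have htadm : t.IsAdmissibleFor M :=
    (CentreSeq.isAdmissibleFor_cons P _ M).mpr ⟨hPsupp, hPsnc, hPreg, trivial⟩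
  have htover : t.CentresOver (P.support : Set X) :=
    (CentreSeq.centresOver_cons P _ _).mpr ⟨subset_rfl, trivial⟩
  have hT : IsClosed (P.support : Set X) := P.support.isClosed
  -- the top is smooth over `k`
  haveI : IsProper t.comp := t.isProper_comp
  have hX₁reg : Scheme.IsRegular t.top :=
    (CentreSeq.IsAdmissibleFor.isMultipleBlowup t M htadm).isRegular hXreg
  haveI : Smooth (t.comp ≫ (X ↘ Spec (.of k))) := smooth_of_isRegular_of_perfectField _ hX₁reg
  -- the transformed marked ideal `(I₁, [π^*P], b)`
  set M₁ : MarkedIdeal t.top := t.transformMarked M with hM₁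
  have hM₁eq : (⟨M₁.ideal, M₁.boundary, b⟩ : MarkedIdeal t.top) = M₁ := by
    rw [show b = M₁.mult from (CentreSeq.transformMarked_mult t M).symm]
  have hmax₁ : ∀ y : t.top, idealOrder M₁.ideal y ≤ b :=
    CentreSeq.IsAdmissibleFor.forall_idealOrder_transformMarked_le t M hXreg htadm hmax
  have hE₁ : HasSNC M₁.boundary :=
    CentreSeq.IsAdmissibleFor.hasSNC_transformMarked_boundary t M htadm (hasSNC_nil_of_isRegular hXreg)
  -- its cosupport lies over `cosupp M ∖ V(P)`
  have hsub₁ : M₁.support ⊆ t.comp ⁻¹' (M.support \ P.support) := by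
    intro y hy
    refine ⟨CentreSeq.IsAdmissibleFor.support_transformMarked_subset_preimage t M htadm hy, fun hyP => ?_⟩
    rw [MarkedIdeal.mem_support_iff] at hy
    have htop : stalkIdeal M₁.ideal y = ⊤ := by
      change stalkIdeal (controlledTransform (blowup.π P) P I b) y = ⊤
      exact stalkIdeal_controlledTransform_eq_top_of_stalkIdeal_eq_pow (blowup.π P) P I b (hIP _ hyP)
    rw [htop, top_le_iff, Ideal.eq_top_iff_one] at hy
    have h1 : (1 : t.top.presheaf.stalk y) ∈ maximalIdeal _ :=
      Ideal.pow_le_self (by rw [CentreSeq.transformMarked_mult]; change b ≠ 0; omega) hy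
    exact (maximalIdeal.isMaximal _).ne_top (Ideal.eq_top_of_isUnit_mem _ h1 isUnit_one)
  have hinj : Set.InjOn t.comp M₁.support := fun y hy y' _ heq => by
    obtain ⟨z, -, hz⟩ := htover.exists_unique_comp_eq_of_not_mem hT (hsub₁ hy).2
    exact (hz y rfl).trans (hz y' heq.symm).symm
  have hfin₁ : M₁.support.Finite :=
    Set.Finite.of_finite_image (hfin.subset (Set.image_subset_iff.mpr hsub₁)) hinj
  have hcl₁ : ∀ y ∈ M₁.support, IsClosed ({y} : Set t.top) := fun y hy =>
    htover.isClosed_singleton_of_comp_eq hT (hsub₁ hy).2 (hcl _ (hsub₁ hy)) rfl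
  have hdim₁ : ∀ y ∈ M₁.support, ringKrullDim (t.top.presheaf.stalk y) ≤ 2 := fun y hy => by
    haveI := htover.isIso_stalkMap_comp_of_not_mem hT (hsub₁ hy).2
    rw [← ringKrullDim_eq_of_ringEquiv (asIso (t.comp.stalkMap y)).commRingCatIsoToRingEquiv]
    exact hdim _ (hsub₁ hy)
  have hdisj₁ : ∀ D' ∈ M₁.boundary, Disjoint (D'.support : Set t.top) M₁.support := fun D' hD' => by
    refine Set.disjoint_left.mpr fun y hyD hyS => ?_
    have h1 := htover.support_boundary_transformMarked_subset t M (P.support : Set X) D' hD' hyD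
    obtain ⟨-, hyP⟩ := hsub₁ hyS
    rcases h1 with h | h
    · exact hyP h
    · obtain ⟨D, hD, -⟩ := Set.mem_iUnion₂.mp h
      simp [hM] at hD
  -- the global sequence of the finite-cosupport theorem on the top, and concatenation
  rw [← hM₁eq] at hfin₁ hcl₁ hdim₁ hdisj₁
  obtain ⟨s₁, hs₁⟩ := exists_isResolutionOf_of_finite_support_boundary k p _ t.top
    (t.comp ≫ (X ↘ Spec (.of k))) M₁.ideal M₁.boundary hb hbp hmax₁ hE₁ hfin₁ hcl₁ hdim₁ hdisj₁ le_rfl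
  rw [hM₁eq] at hs₁
  exact ⟨t.append s₁, htadm.append hs₁⟩

end Kollar2007

end Literature.AlgebraicGeometry.Resolution

end
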